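import Summits.ABC.ABC.Theses.IsogenyGlueCongruence
import Literature.NumberTheory.EllipticCurves.PastenSpectralDegreeIsogenyBoundProofs
import Literature.NumberTheory.EllipticCurves.LatticeMultiplierIndex
import Literature.NumberTheory.EllipticCurves.EichlerShimuraConstructionProofs
import Literature.NumberTheory.EllipticCurves.HeegnerPointsModularityProofs
import Literature.NumberTheory.Automorphic.ShimuraCurveRibetTakahashiOptimalProofs

/-!
# Disproof of `MazurKenkuBound` (crux `stmt-ABC-15125`, route IsogenyGlueCongruence) — findings

Standing disprover's work file (refuter-cdisprove-stmt-ABC-15125-0, cycle 1, 2026-08-16). The crux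
(`deg D' ≤ 163 · deg D` for a class-minimal datum `D` and a minimal datum `D'` of a GLOBALLY MINIMAL
`W'` with the same newform) is definitionally the vendored fact
`PastenShimura2024_minimalDegree_le_163_mul`; in print it is Mazur 1978 Thm 1 + Kenku 1982 + Néron
functoriality, so NO unconditional kill is expected. Everything below is sorry-free, axioms
`propext / Classical.choice / Quot.sound`. LANDING COPIES (importable once accepted):
`Summits/ABC/ABC/Theorems/MazurKenkuBound/Negative/LoadBearing.lean` (p103098: tool, both
`_false_without_` witnesses modulo the single hypothesis `SomeCurveParametrised`, with the general
`exists_datum_smul` / `exists_globallyMinimal_nonempty`) and `.../Negative/StrongForm.lean`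
(p101774: (ii) redundant, divisibility form, `iff_hMK`). Findings:

* (a.ii) `mazurKenkuBound_iff_withoutDMin` — hypothesis (ii) (class-minimality of `D`) is REDUNDANT
  (well-ordering; fact-free). Provers may ignore `hmin`.
* (a.iii) `mazurKenkuBound_false_without_DPrimeMin_of` — hypothesis (iii) (minimality of `D'`) is
  LOAD-BEARING: modulo H = `SomeMinimalCurveParametrised` (one globally minimal curve carries a datum;
  = route item `ModularDatumExists` at one curve) the statement without (iii) is false — witness the
  datum with Manin constant `13 c`, degree `≥ 169 δ`.
* (a.i) `mazurKenkuBound_false_without_minimalModel_of` — the instance `[W'.IsGloballyMinimal]` is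
  LOAD-BEARING: modulo H' = `SomeCurveParametrised` the statement over arbitrary elliptic `W'` is
  false — witness the rescaled model `13⁻¹ • E_f` (Néron-type lattice `13⁻¹ Λ_f`), whose MINIMAL
  datum has degree `≥ 169 δ` (`exists_datum_thirteenInv_smul`). This is the formal shadow of "the
  Manin constant of a non-minimal model need not be an integer".
* (a.iv) `someMinimalCurveParametrised_of_someCurveParametrised` — H' ⟹ H, so BOTH witnesses need
  only ONE parametrised elliptic curve over `ℚ` (`someCurveParametrised_iff`: = one curve with a
  newform, a Néron pair and an integral Manin constant; `mazurKenkuBound_false_without_DPrimeMin_of'`).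
* tool: `sq_le_natCard_ker_isogenyMap` — `k² ≤ [Λ_E : c Λ_f]` from a `k`-divisibility pattern
  (index `[Λ : kΛ] = k²`, tree `PeriodPair.natCard_quotient_range_mulLeft`).
* (c) `modularDegree_dvd_of_classMinimal` — the divisibility `deg D ∣ deg D'` holds UNCONDITIONALLY
  under (i)+(ii); the open content is only the cofactor bound `≤ 163` = `hMK`
  (`mazurKenkuBound_iff_hMK`, tree), i.e. Mazur–Kenku + Néron integrality `hInt`.
* (d) targets of line `Sketch`: none handed over yet; remark on the `hInt` stubs.
* (e) paper-only: (i) `hf` load-bearing, `163` tight at `N = 26569` (CM `−163`), no exotic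
  inhabitants of `ModularParametrizationData`.
-/

-- `Summit.ABC.ABC` is the mandated summit-side namespace (CONVENTIONS §2); the duplicate is
-- deliberate.
set_option linter.dupNamespace false

noncomputable section

namespace Summit.ABC.ABC.Cruxes.MazurKenkuBound.Disproof

open Literature.NumberTheory.EllipticCurves.ModularForms
open Summit.ABC.ABC.Theses.IsogenyGlueCongruence
open scoped MatrixGroups ModularForm
open CongruenceSubgroup

/-! ## (a) Load-bearing analysis -/

/-- `MazurKenkuBound` with hypothesis (ii) — "`D` has minimal degree among ALL data with the same
newform" — DROPPED. -/
def MazurKenkuBoundWithoutDMin : Prop :=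
  ∀ (N : ℕ) [NeZero N] (W W' : WeierstrassCurve ℚ) [W.IsElliptic] [W'.IsElliptic]
    [W'.IsGloballyMinimal] (D : ModularParametrizationData W N)
    (D' : ModularParametrizationData W' N), D'.f = D.f →
    (∀ D'' : ModularParametrizationData W' N, D'.modularDegree ≤ D''.modularDegree) →
    D'.modularDegree ≤ 163 * D.modularDegree

/-- **Hypothesis (ii) is redundant**: `MazurKenkuBound ↔ MazurKenkuBoundWithoutDMin`, with no
input at all (well-ordering of `ℕ`: replace `D` by a datum of least degree in the class, which
satisfies (ii), and use `deg D₀ ≤ deg D`). Information for the prover: any proof may ignore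
`hmin`; the tree's reduction `PastenShimura2024_minimalDegree_le_163_mul_of` already binds it as `_`. -/
theorem mazurKenkuBound_iff_withoutDMin : MazurKenkuBound ↔ MazurKenkuBoundWithoutDMin := by
  classical
  refine ⟨fun h ↦ ?_, fun h ↦ ?_⟩
  · intro N _ W W' _ _ _ D D' hf hmin'
    have hex : ∃ n, ∃ (W'' : WeierstrassCurve ℚ) (_ : W''.IsElliptic)
        (D'' : ModularParametrizationData W'' N), D''.f = D.f ∧ D''.modularDegree = n :=
      ⟨_, W, ‹_›, D, rfl, rfl⟩
    obtain ⟨W₀, hW₀, D₀, hf₀, hdeg₀⟩ := Nat.find_spec hex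
    haveI := hW₀
    have hmin₀ : ∀ (W'' : WeierstrassCurve ℚ) [W''.IsElliptic]
        (D'' : ModularParametrizationData W'' N), D''.f = D₀.f →
          D₀.modularDegree ≤ D''.modularDegree := fun W'' _ D'' hD'' ↦ by
      rw [hdeg₀]
      exact Nat.find_min' hex ⟨W'', ‹_›, D'', hD''.trans hf₀, rfl⟩
    have h1 : D'.modularDegree ≤ 163 * D₀.modularDegree :=
      h N W₀ W' D₀ D' (hf.trans hf₀.symm) hmin₀ hmin'
    have h2 : D₀.modularDegree ≤ D.modularDegree := hmin₀ W D hf₀.symm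
    calc D'.modularDegree ≤ 163 * D₀.modularDegree := h1
      _ ≤ 163 * D.modularDegree := Nat.mul_le_mul_left 163 h2
  · intro N _ W W' _ _ _ D D' hf _ hmin'
    exact h N W W' D D' hf hmin'

/-! ### The index tool: `k² ≤ [Λ_E : c Λ_f]` from `k`-divisibility of the Manin constant -/

/-- **Kernel lower bound.** Let `Dx` be a datum (`c Λ_f ⊆ Λ_E`, isogeny `z ↦ c z : ℂ/Λ_f → ℂ/Λ_E`)
and `L` a period pair, `β ∈ ℂ`, `k ≥ 1` such that `c β Λ_L ⊆ Λ_E` (so `λ ↦ β λ (mod Λ_f)` maps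
`Λ_L` into `ker`) and `β λ ∈ Λ_f ⇒ λ ∈ k Λ_L` (its kernel lies in `k Λ_L`). Then
`k² = [Λ_L : k Λ_L] ≤ #ker(z ↦ c z)` (the index `[Λ : kΛ] = k k̄ = k²` is the tree's
`PeriodPair.natCard_quotient_range_mulLeft`). [folklore] -/
theorem sq_le_natCard_ker_isogenyMap {W : WeierstrassCurve ℚ} {N : ℕ} [NeZero N]
    (Dx : ModularParametrizationData W N) (L : PeriodPair) {β : ℂ} {k : ℕ} (hk : k ≠ 0)
    (h_in : ∀ l ∈ L.lattice, (Dx.c : ℂ) * (β * l) ∈ Dx.L.lattice)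
    (h_out : ∀ l ∈ L.lattice, β * l ∈ periodLattice Dx.f → ∃ l' ∈ L.lattice, l = (k : ℂ) * l')
    [Finite Dx.isogenyMap.ker] : k ^ 2 ≤ Nat.card Dx.isogenyMap.ker := by
  have hk0 : (k : ℂ) ≠ 0 := Nat.cast_ne_zero.mpr hk
  -- `ψ : Λ_L → ℂ/Λ_f`, `λ ↦ β λ`
  set ψ : L.lattice →+ ℂ ⧸ periodLattice Dx.f :=
    (QuotientAddGroup.mk' (periodLattice Dx.f)).comp
      ((AddMonoidHom.mulLeft β).comp L.lattice.subtype.toAddMonoidHom) with hψ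
  have hψ_apply : ∀ l : L.lattice, ψ l = ((β * (l : ℂ) : ℂ) : ℂ ⧸ periodLattice Dx.f) :=
    fun _ ↦ rfl
  -- its range lies in the kernel of the isogeny
  have hrange : ψ.range ≤ Dx.isogenyMap.ker := by
    rintro _ ⟨l, rfl⟩
    rw [AddMonoidHom.mem_ker, hψ_apply, Dx.isogenyMap_mk, QuotientAddGroup.eq_zero_iff]
    exact h_in l l.2
  -- its kernel lies in `k Λ_L`
  have hα : ∀ l ∈ L.lattice, (k : ℂ) * l ∈ L.lattice := fun l hl ↦ by
    simpa [nsmul_eq_mul] using nsmul_mem hl k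
  set Nk : Submodule ℤ L.lattice := LinearMap.range ((LinearMap.mulLeft ℤ (k : ℂ)).restrict hα)
    with hNk
  have hker : ψ.ker ≤ Nk.toAddSubgroup := by
    intro l hl
    rw [AddMonoidHom.mem_ker, hψ_apply, QuotientAddGroup.eq_zero_iff] at hl
    obtain ⟨l', hl', hll'⟩ := h_out l l.2 hl
    rw [Submodule.mem_toAddSubgroup, hNk, PeriodPair.mem_range_restrict_mulLeft_iff]
    exact ⟨l', hl', hll'⟩
  -- `[Λ_L : k Λ_L] = k²`
  have hidx : Nk.toAddSubgroup.index = k ^ 2 := by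
    have h := L.natCard_quotient_range_mulLeft hα hk0
    rw [map_natCast] at h
    have h' : ((Nat.card (L.lattice ⧸ Nk) : ℕ) : ℂ) = ((k ^ 2 : ℕ) : ℂ) := by
      rw [hNk, h]; push_cast; ring
    exact_mod_cast h'
  -- count
  have hfinR : Finite ψ.range :=
    Finite.of_injective _ (AddSubgroup.inclusion_injective hrange)
  have hpos : 0 < Nat.card ψ.range := Nat.card_pos
  have hdvd : k ^ 2 ∣ Nat.card ψ.range := by
    rw [← AddSubgroup.index_ker ψ, ← hidx]
    exact AddSubgroup.index_dvd_of_le hker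
  exact (Nat.le_of_dvd hpos hdvd).trans (AddSubgroup.card_le_of_le hrange)

/-! ### (a.iii) Hypothesis (iii) `hmin'` (minimality of `D'` among the data of `W'`) is load-bearing -/

/-- `MazurKenkuBound` with hypothesis (iii) — "`D'` has minimal degree among the data of `W'`" —
DROPPED. FALSE as soon as one globally minimal elliptic curve over `ℚ` carries a datum
(`mazurKenkuBound_false_without_DPrimeMin_of`). -/
def MazurKenkuBoundWithoutDPrimeMin : Prop :=
  ∀ (N : ℕ) [NeZero N] (W W' : WeierstrassCurve ℚ) [W.IsElliptic] [W'.IsElliptic]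
    [W'.IsGloballyMinimal] (D : ModularParametrizationData W N)
    (D' : ModularParametrizationData W' N), D'.f = D.f →
    (∀ (W'' : WeierstrassCurve ℚ) [W''.IsElliptic] (D'' : ModularParametrizationData W'' N),
      D''.f = D.f → D.modularDegree ≤ D''.modularDegree) →
    D'.modularDegree ≤ 163 * D.modularDegree

/-- **H (existence side, not constructible in the tree today):** some globally minimal elliptic
curve over `ℚ` admits a modular parametrisation datum at some level. A consequence of the route
item `ModularDatumExists` (stmt-ABC-15126 = `nonempty_modularParametrizationData`, BCDT 2001) at any
one curve, e.g. `11a1`; in print a theorem (Wiles 1995 for `X₀(11)`), in the tree the missing piece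
is only modularity (uniformisation, Manin constant and degree are theorems of the tree).
[cite: BCDTJAMS2001, Thm. A] -/
def SomeMinimalCurveParametrised : Prop :=
  ∃ (N : ℕ) (_ : NeZero N) (W : WeierstrassCurve ℚ) (_ : W.IsElliptic) (_ : W.IsGloballyMinimal),
    Nonempty (ModularParametrizationData W N)

/-- **`hmin'` is load-bearing (modulo H = `SomeMinimalCurveParametrised`).** Witness: let `D` be a
datum of a globally minimal `W` (from H), `f` its newform, `δ` the degree of the Eichler–Shimura map
`Y₀(N) → ℂ/Λ_f`, `D₀` the optimal datum of the strong Weil curve `W₀` (`exists_optimalDatum'`,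
`deg D₀ = δ`, minimal in the class), and `D₁₃` the datum of `W` with Manin constant `13 c`
(`exists_datum_c_eq`). Then `deg D₁₃ = [Λ_E : 13 c Λ_f] · δ ≥ 13² δ = 169 δ > 163 δ = 163 · deg D₀`
(`sq_le_natCard_ker_isogenyMap` with `β = (13c)⁻¹`), so the triple `(D₀, W, D₁₃)` violates the
statement without `hmin'`. Any proof of the crux must use the minimality of `D'`. [folklore] -/
theorem mazurKenkuBound_false_without_DPrimeMin_of (h : SomeMinimalCurveParametrised) :
    ¬ MazurKenkuBoundWithoutDPrimeMin := by
  intro hMK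
  obtain ⟨N, hN, W, hW, hWmin, ⟨D⟩⟩ := h
  have hf0 : D.f ≠ 0 := D.isNewformOf.1.ne_zero
  have hc0 := D.cast_c_ne_zero
  haveI := discreteTopology_periodLattice_of_mul_mem D.f hc0 D.smul_periodLattice_le
  obtain ⟨δ, hδ, hfinδ⟩ := exists_degree_eichlerShimuraMap' (N := N) hf0
  -- the optimal datum `D₀`: minimal in the class, of degree `δ`
  obtain ⟨W₀, hW₀, D₀, hf₀, h₀⟩ := D.exists_optimalDatum'
  haveI := hW₀
  have hker₀ : D₀.isogenyMap.ker = ⊥ := D₀.isogenyMap_ker_eq_bot_iff.mpr h₀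
  have hmin₀ : ∀ (W'' : WeierstrassCurve ℚ) [W''.IsElliptic]
      (D'' : ModularParametrizationData W'' N), D''.f = D₀.f →
        D₀.modularDegree ≤ D''.modularDegree := fun W'' _ D'' hD'' ↦
    D₀.modularDegree_le_of_isogenyMap_ker_eq_bot hker₀ D'' hD''
  have hdeg₀ : D₀.modularDegree = δ := by
    obtain ⟨-, h⟩ := D₀.modularDegree_eq_card_ker_mul_of_eichlerShimuraMap hf₀ hδ hfinδ
    rw [h, hker₀, AddSubgroup.card_bot, one_mul]
  -- the datum `D₁₃` of `W` with Manin constant `13 c`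
  have hk : ∀ z ∈ periodLattice D.f, (((13 : ℤ) * D.c : ℤ) : ℂ) * z ∈ D.L.lattice := fun z hz ↦ by
    have h1 := nsmul_mem (D.smul_periodLattice_le z hz) 13
    have h2 : (((13 : ℤ) * D.c : ℤ) : ℂ) * z = 13 • ((D.c : ℂ) * z) := by
      rw [nsmul_eq_mul]; push_cast; ring
    rwa [h2]
  have hk0 : ((13 : ℤ) * D.c : ℤ) ≠ 0 := mul_ne_zero (by norm_num) D.maninConstant_ne_zero_holds
  obtain ⟨Dk, hfk, hLk, -, hck⟩ := D.exists_datum_c_eq hk0 hk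
  -- the mutilated statement applied to `(D₀, W, D₁₃)`
  have h163 : Dk.modularDegree ≤ 163 * D₀.modularDegree :=
    hMK N W₀ W D₀ Dk (hfk.trans hf₀.symm) hmin₀
  obtain ⟨hfinK, hdegK⟩ := Dk.modularDegree_eq_card_ker_mul_of_eichlerShimuraMap hfk hδ hfinδ
  haveI := hfinK
  have h_in : ∀ l ∈ Dk.L.lattice, (Dk.c : ℂ) * (((Dk.c : ℂ))⁻¹ * l) ∈ Dk.L.lattice :=
    fun l hl ↦ by rwa [mul_inv_cancel_left₀ Dk.cast_c_ne_zero]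
  have h_out : ∀ l ∈ Dk.L.lattice, ((Dk.c : ℂ))⁻¹ * l ∈ periodLattice Dk.f →
      ∃ l' ∈ Dk.L.lattice, l = ((13 : ℕ) : ℂ) * l' := fun l hl hmem ↦ by
    have h1 : (D.c : ℂ) * (((Dk.c : ℂ))⁻¹ * l) ∈ D.L.lattice :=
      D.smul_periodLattice_le _ (hfk ▸ hmem)
    have h2 : (D.c : ℂ) * (((Dk.c : ℂ))⁻¹ * l) = ((13 : ℂ))⁻¹ * l := by
      rw [hck]; push_cast; field_simp
    refine ⟨((13 : ℂ))⁻¹ * l, ?_, ?_⟩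
    · rw [hLk, ← h2]; exact h1
    · push_cast; rw [mul_inv_cancel_left₀ (by norm_num : (13 : ℂ) ≠ 0)]
  have hge : 13 ^ 2 ≤ Nat.card Dk.isogenyMap.ker :=
    sq_le_natCard_ker_isogenyMap Dk Dk.L (by norm_num) h_in h_out
  -- `169 δ ≤ deg D₁₃ ≤ 163 δ` with `δ ≥ 1`
  have hcontra : 13 ^ 2 * δ ≤ 163 * δ :=
    calc 13 ^ 2 * δ ≤ Nat.card Dk.isogenyMap.ker * δ := Nat.mul_le_mul_right δ hge
      _ = Dk.modularDegree := hdegK.symm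
      _ ≤ 163 * D₀.modularDegree := h163
      _ = 163 * δ := by rw [hdeg₀]
  have := Nat.le_of_mul_le_mul_right hcontra hδ
  omega

/-! ### (a.i) The instance hypothesis `[W'.IsGloballyMinimal]` is load-bearing -/

/-- `MazurKenkuBound` with the instance hypothesis `[W'.IsGloballyMinimal]` DROPPED (everything
else, including both minimality hypotheses, kept). FALSE as soon as one elliptic curve over `ℚ`
carries a datum (`mazurKenkuBound_false_without_minimalModel_of`). -/
def MazurKenkuBoundWithoutMinimalModel : Prop :=
  ∀ (N : ℕ) [NeZero N] (W W' : WeierstrassCurve ℚ) [W.IsElliptic] [W'.IsElliptic]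
    (D : ModularParametrizationData W N) (D' : ModularParametrizationData W' N), D'.f = D.f →
    (∀ (W'' : WeierstrassCurve ℚ) [W''.IsElliptic] (D'' : ModularParametrizationData W'' N),
      D''.f = D.f → D.modularDegree ≤ D''.modularDegree) →
    (∀ D'' : ModularParametrizationData W' N, D'.modularDegree ≤ D''.modularDegree) →
    D'.modularDegree ≤ 163 * D.modularDegree

/-- **H' (weaker than H):** some elliptic curve over `ℚ` admits a datum at some level. -/
def SomeCurveParametrised : Prop :=
  ∃ (N : ℕ) (_ : NeZero N) (W : WeierstrassCurve ℚ) (_ : W.IsElliptic),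
    Nonempty (ModularParametrizationData W N)

/-- H ⟹ H'. [folklore] -/
theorem someCurveParametrised_of_minimal (h : SomeMinimalCurveParametrised) :
    SomeCurveParametrised := by
  obtain ⟨N, hN, W, hW, -, hD⟩ := h
  exact ⟨N, hN, W, hW, hD⟩

/-- The rescaling `(x, y) ↦ (13² x, 13³ y)` as an admissible change of variables `u = 13⁻¹`:
`aᵢ ↦ 13ⁱ aᵢ`, `ω ↦ 13⁻¹ ω`, Néron-type lattice `Λ ↦ 13⁻¹ Λ` (Silverman AEC III.1, Table 3.1).
[cite: SilvermanAEC2009, III.1 Table 3.1 (PDF p. 50)] -/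
def thirteenInv : WeierstrassCurve.VariableChange ℚ :=
  ⟨Units.mk0 (13 : ℚ)⁻¹ (by norm_num), 0, 0, 0⟩

/-- **A datum on the NON-minimal model `13⁻¹ • E_f`.** For every datum `D` (newform `f`) there are:
the `ℚ`-model `W₀ = E_f` of `ℂ/Λ_f` (`exists_latticeEq_model`) with a period pair `L₀`,
`Λ_{L₀} = Λ_f`; its rescaled model `W' = thirteenInv • W₀` (integral up to clearing denominators is
irrelevant: any elliptic `W'/ℚ` is allowed once `IsGloballyMinimal` is dropped) with a Néron-type
period pair `L'` spanning `13⁻¹ Λ_f ⊋ Λ_f`; and a datum `D'` of `W'` with the same newform and Manin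
constant `1` (admissible because `Λ_f ⊆ 13⁻¹ Λ_f`; uniformisation and degree are the tree's theorems
`IsNeronLatticeOf.exists_uniformize_holds`, `exists_modularDegree_holds`). [folklore] -/
theorem exists_datum_thirteenInv_smul {W : WeierstrassCurve ℚ} {N : ℕ} [NeZero N] [W.IsElliptic]
    (D : ModularParametrizationData W N) :
    ∃ (W₀ : WeierstrassCurve ℚ) (_ : W₀.IsElliptic) (L₀ L' : PeriodPair),
      (L₀.lattice : Set ℂ) = periodLattice D.f ∧
      IsNeronLatticeOf ((thirteenInv • W₀).baseChange ℂ) L' ∧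
      (∀ x : ℂ, x ∈ L'.lattice ↔ 13 * x ∈ L₀.lattice) ∧
      ∃ D' : ModularParametrizationData (thirteenInv • W₀) N, D'.f = D.f ∧ D'.c = 1 := by
  have hf0 : D.f ≠ 0 := D.isNewformOf.1.ne_zero
  obtain ⟨W₀, hW₀, hfW₀, L₀, hL₀, hΛ⟩ := D.exists_latticeEq_model
  haveI := hW₀
  have hmem₀ : ∀ z : ℂ, z ∈ L₀.lattice ↔ z ∈ periodLattice D.f := fun z ↦ by
    rw [← SetLike.mem_coe, hΛ, SetLike.mem_coe]
  -- the Néron-type period pair `13⁻¹ L₀` of the rescaled model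
  set Cc : WeierstrassCurve.VariableChange ℂ := thirteenInv.map (algebraMap ℚ ℂ) with hCc
  have hmap : (thirteenInv • W₀).baseChange ℂ = Cc • W₀.baseChange ℂ := by
    simp only [hCc, WeierstrassCurve.baseChange, WeierstrassCurve.map_variableChange]
  set L' : PeriodPair := L₀.mulLeft ((Cc.u : ℂˣ) : ℂ) Cc.u.ne_zero with hL'def
  have hL' : IsNeronLatticeOf ((thirteenInv • W₀).baseChange ℂ) L' := by
    rw [hmap]; exact hL₀.smul Cc
  have hu : ((Cc.u : ℂˣ) : ℂ) = (13 : ℂ)⁻¹ := by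
    simp [hCc, thirteenInv, WeierstrassCurve.VariableChange.map]
  have hmem' : ∀ x : ℂ, x ∈ L'.lattice ↔ 13 * x ∈ L₀.lattice := fun x ↦ by
    rw [hL'def, PeriodPair.mem_mulLeft_lattice, hu, inv_inv]
  -- uniformisation of the rescaled model
  haveI : ((thirteenInv • W₀).baseChange ℂ).IsElliptic := by
    rw [WeierstrassCurve.baseChange]; infer_instance
  obtain ⟨u, hker, hsurj, hspec⟩ := IsNeronLatticeOf.exists_uniformize_holds hL'
  -- `1 · Λ_f ⊆ 13⁻¹ Λ_f`
  have hc1 : ∀ z ∈ periodLattice D.f, ((1 : ℤ) : ℂ) * z ∈ L'.lattice := fun z hz ↦ by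
    rw [Int.cast_one, one_mul, hmem']
    simpa [nsmul_eq_mul] using nsmul_mem ((hmem₀ z).mpr hz) 13
  -- the degree of `Γ₀(N)τ ↦ 2πi ∫ f (mod 13⁻¹ Λ_f)`, transported to `W'(ℂ)`
  obtain ⟨d, hd, hfin⟩ := exists_modularDegree_holds hf0 (L := L') (c := ((1 : ℤ) : ℂ))
    (Int.cast_ne_zero.mpr one_ne_zero) hc1
  have hker' : L'.lattice.toAddSubgroup = u.ker :=
    SetLike.coe_injective (by rw [Submodule.coe_toAddSubgroup, hker])
  let e : ℂ ⧸ L'.lattice.toAddSubgroup ≃+ ((thirteenInv • W₀).baseChange ℂ).toAffine.Point :=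
    QuotientAddGroup.liftEquiv L'.lattice.toAddSubgroup hsurj hker'
  have he : ∀ x : ℂ, e.toEquiv (x : ℂ ⧸ L'.lattice.toAddSubgroup) = u x := fun _ ↦ rfl
  have key := (finite_setOf_card_fiberOrbits_ne_iff e.toEquiv
    (fun τ : UpperHalfPlane ↦
      ((((1 : ℤ) : ℂ) * eichlerIntegral D.f τ : ℂ) : ℂ ⧸ L'.lattice.toAddSubgroup)) d).mpr hfin
  simp only [he] at key
  refine ⟨W₀, hW₀, L₀, L', hΛ, hL', hmem', ?_⟩
  exact ⟨{ f := D.f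
           isNewformOf := hfW₀.of_isIsogenous (WeierstrassCurve.isIsogenous_of_smul W₀ thirteenInv)
           L := L'
           isNeronLattice := hL'
           uniformize := u
           ker_uniformize := hker
           uniformize_surjective := hsurj
           uniformize_spec := hspec
           c := 1
           smul_periodLattice_le := hc1
           deg := d
           deg_pos := hd
           deg_spec := key }, rfl, rfl⟩

/-- **`[W'.IsGloballyMinimal]` is load-bearing (modulo H' = `SomeCurveParametrised`).** Witness:
from a datum `D` (newform `f`, Eichler–Shimura degree `δ`) take the optimal datum `D₀` (`deg = δ`,
minimal in the class) and the rescaled model `W' = 13⁻¹ • E_f` with its Néron-type lattice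
`13⁻¹ Λ_f` (`exists_datum_thirteenInv_smul`). A datum `D₁` of `W'` of MINIMAL degree exists
(`exists_minimal_datum`), and still `deg D₁ = [13⁻¹Λ_f : c₁ Λ_f] · δ ≥ 13² δ`
(`sq_le_natCard_ker_isogenyMap` with `β = (13 c₁)⁻¹`: `λ/(13c₁)`, `λ ∈ Λ_f`, are `169` kernel
classes), so `(D₀, W', D₁)` satisfies every remaining hypothesis and `169 δ ≤ 163 δ` fails. In words:
for a non-minimal model the Manin "constant" of the cheapest parametrisation is `1/13 ∉ ℤ`, the
structure only admits integral constants, and the cheapest ADMISSIBLE datum is `[13] ∘ (that map)`,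
of degree `169 ×` the optimal one. [folklore] -/
theorem mazurKenkuBound_false_without_minimalModel_of (h : SomeCurveParametrised) :
    ¬ MazurKenkuBoundWithoutMinimalModel := by
  intro hMK
  obtain ⟨N, hN, W, hW, ⟨D⟩⟩ := h
  have hf0 : D.f ≠ 0 := D.isNewformOf.1.ne_zero
  have hc0 := D.cast_c_ne_zero
  haveI := discreteTopology_periodLattice_of_mul_mem D.f hc0 D.smul_periodLattice_le
  obtain ⟨δ, hδ, hfinδ⟩ := exists_degree_eichlerShimuraMap' (N := N) hf0
  -- the optimal datum `D₀`: minimal in the class, of degree `δ`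
  obtain ⟨W₀, hW₀, D₀, hf₀, h₀⟩ := D.exists_optimalDatum'
  haveI := hW₀
  have hker₀ : D₀.isogenyMap.ker = ⊥ := D₀.isogenyMap_ker_eq_bot_iff.mpr h₀
  have hmin₀ : ∀ (W'' : WeierstrassCurve ℚ) [W''.IsElliptic]
      (D'' : ModularParametrizationData W'' N), D''.f = D₀.f →
        D₀.modularDegree ≤ D''.modularDegree := fun W'' _ D'' hD'' ↦
    D₀.modularDegree_le_of_isogenyMap_ker_eq_bot hker₀ D'' hD''
  have hdeg₀ : D₀.modularDegree = δ := by
    obtain ⟨-, h⟩ := D₀.modularDegree_eq_card_ker_mul_of_eichlerShimuraMap hf₀ hδ hfinδ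
    rw [h, hker₀, AddSubgroup.card_bot, one_mul]
  -- the rescaled model `W' = 13⁻¹ • E_f` and a minimal datum `D₁` of it
  obtain ⟨W₁, hW₁, L₀, L', hΛ, hL', hmem', D', hf', -⟩ := exists_datum_thirteenInv_smul D
  haveI := hW₁
  have hmem₀ : ∀ z : ℂ, z ∈ L₀.lattice ↔ z ∈ periodLattice D.f := fun z ↦ by
    rw [← SetLike.mem_coe, hΛ, SetLike.mem_coe]
  obtain ⟨D₁, -, hD₁⟩ := exists_minimal_datum (W := thirteenInv • W₁) (N := N) ⟨D'⟩
  have hf₁ : D₁.f = D.f := (D₁.isNewformOf.unique D'.isNewformOf).trans hf'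
  have hΛ₁ : D₁.L.lattice = L'.lattice := IsNeronLatticeOf.lattice_eq D₁.isNeronLattice hL'
  -- the mutilated statement applied to `(D₀, W', D₁)`
  have h163 : D₁.modularDegree ≤ 163 * D₀.modularDegree :=
    hMK N W₀ (thirteenInv • W₁) D₀ D₁ (hf₁.trans hf₀.symm) hmin₀ hD₁
  obtain ⟨hfin₁, hdeg₁⟩ := D₁.modularDegree_eq_card_ker_mul_of_eichlerShimuraMap hf₁ hδ hfinδ
  haveI := hfin₁
  have hc₁ := D₁.cast_c_ne_zero
  have h13 : (13 : ℂ) ≠ 0 := by norm_num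
  have h_in : ∀ l ∈ L₀.lattice, (D₁.c : ℂ) * (((13 : ℂ) * D₁.c)⁻¹ * l) ∈ D₁.L.lattice :=
    fun l hl ↦ by
    have h2 : (D₁.c : ℂ) * (((13 : ℂ) * D₁.c)⁻¹ * l) = ((13 : ℂ))⁻¹ * l := by field_simp
    rw [h2, hΛ₁, hmem', mul_inv_cancel_left₀ h13]
    exact hl
  have h_out : ∀ l ∈ L₀.lattice, ((13 : ℂ) * D₁.c)⁻¹ * l ∈ periodLattice D₁.f →
      ∃ l' ∈ L₀.lattice, l = ((13 : ℕ) : ℂ) * l' := fun l _ hmem ↦ by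
    have h1 : ((13 : ℂ) * D₁.c)⁻¹ * l ∈ L₀.lattice := (hmem₀ _).mpr (hf₁ ▸ hmem)
    refine ⟨(D₁.c : ℂ) * (((13 : ℂ) * D₁.c)⁻¹ * l), ?_, ?_⟩
    · simpa [zsmul_eq_mul] using zsmul_mem h1 D₁.c
    · push_cast; field_simp
  have hge : 13 ^ 2 ≤ Nat.card D₁.isogenyMap.ker :=
    sq_le_natCard_ker_isogenyMap D₁ L₀ (by norm_num) h_in h_out
  -- `169 δ ≤ deg D₁ ≤ 163 δ` with `δ ≥ 1`
  have hcontra : 13 ^ 2 * δ ≤ 163 * δ :=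
    calc 13 ^ 2 * δ ≤ Nat.card D₁.isogenyMap.ker * δ := Nat.mul_le_mul_right δ hge
      _ = D₁.modularDegree := hdeg₁.symm
      _ ≤ 163 * D₀.modularDegree := h163
      _ = 163 * δ := by rw [hdeg₀]
  have := Nat.le_of_mul_le_mul_right hcontra hδ
  omega

/-! ### (a.iv) One hypothesis for both witnesses: H' ⟹ H -/

/-- **H' ⟹ H**: from any datum, the global minimal model `W₀` of `E_f` (tree
`exists_isGloballyMinimal_latticeEq_rat`: Néron lattice `q Λ_f`, `q ∈ ℚˣ`, same newform) carries a
datum with Manin constant `num q` (`nonempty_of_isNewformOf`: uniformisation and degree are theorems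
of the tree). Hence BOTH `_false_without_` witnesses need only ONE parametrised elliptic curve over
`ℚ` — i.e. the modularity (`IsNewformOf W f` + a Manin constant) of a single curve, e.g. `X₀(11)`.
[folklore] -/
theorem someMinimalCurveParametrised_of_someCurveParametrised (h : SomeCurveParametrised) :
    SomeMinimalCurveParametrised := by
  obtain ⟨N, hN, W, hW, ⟨D⟩⟩ := h
  obtain ⟨W₀, hW₀, hW₀min, L₀, q, hf₀, hL₀, hq0, hq, -⟩ := D.exists_isGloballyMinimal_latticeEq_rat
  haveI := hW₀
  haveI := hW₀min
  have hc0 : q.num ≠ 0 := Rat.num_ne_zero.mpr hq0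
  have hc : ∀ z ∈ periodLattice D.f, ((q.num : ℤ) : ℂ) * z ∈ L₀.lattice := fun z hz ↦ by
    have hmem := hq z hz
    have hnum : ((q.num : ℤ) : ℂ) = (q.den : ℂ) * (q : ℂ) := by
      have h' : ((q.den : ℚ) : ℂ) * ((q : ℚ) : ℂ) = ((q.num : ℚ) : ℂ) := by
        rw [← Rat.cast_mul, Rat.den_mul_eq_num]
      simpa using h'.symm
    rw [hnum, mul_assoc]
    simpa [nsmul_eq_mul] using nsmul_mem hmem q.den
  exact ⟨N, hN, W₀, hW₀, hW₀min,
    ModularParametrizationData.nonempty_of_isNewformOf hf₀ hL₀ hc0 hc⟩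

/-- **`hmin'` is load-bearing modulo H' alone** (`SomeCurveParametrised`: one elliptic curve over `ℚ`
carries a datum). [folklore] -/
theorem mazurKenkuBound_false_without_DPrimeMin_of' (h : SomeCurveParametrised) :
    ¬ MazurKenkuBoundWithoutDPrimeMin :=
  mazurKenkuBound_false_without_DPrimeMin_of (someMinimalCurveParametrised_of_someCurveParametrised h)

/-- **H' unfolded: one modular curve.** `SomeCurveParametrised` holds as soon as ONE elliptic `W/ℚ`
has a newform `f` at some level with a Néron-type period pair `L` and an integer `c ≠ 0`,
`c Λ_f ⊆ Λ_L` (tree `nonempty_of_isNewformOf`); conversely every datum provides these. So the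
residual hypothesis of the negative lemmas is exactly "modularity with a Manin constant of one
elliptic curve over `ℚ`" (Eichler 1954 / Shimura for `X₀(11) = 11a1` in print; in the tree only the
general named fact `exists_isNewformOf` + `IsNewformOf.exists_maninConstant_ne_zero`). [folklore] -/
theorem someCurveParametrised_iff :
    SomeCurveParametrised ↔
      ∃ (N : ℕ) (_ : NeZero N) (W : WeierstrassCurve ℚ) (_ : W.IsElliptic)
        (f : CuspForm (Gamma0 N) 2), IsNewformOf W f ∧ ∃ L : PeriodPair,
          IsNeronLatticeOf (W.baseChange ℂ) L ∧
            ∃ c : ℤ, c ≠ 0 ∧ ∀ z ∈ periodLattice f, (c : ℂ) * z ∈ L.lattice := by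
  constructor
  · rintro ⟨N, hN, W, hW, hD⟩
    exact ⟨N, hN, W, hW, (ModularParametrizationData.nonempty_iff_exists_isNewformOf).mp hD⟩
  · rintro ⟨N, hN, W, hW, h⟩
    exact ⟨N, hN, W, hW, (ModularParametrizationData.nonempty_iff_exists_isNewformOf).mpr h⟩

/-! ## (c) The TRUE sharper form: divisibility (unconditional) — and what exactly is open -/

/-- **Divisibility form, proved.** Under hypotheses (i) `D'.f = D.f` and (ii) (class-minimality of
`D`) alone — no minimality of `D'`, no `IsGloballyMinimal` — `deg D ∣ deg D'`: `deg D = δ` (the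
Eichler–Shimura degree; an optimal datum of degree `δ` exists, `exists_optimalDatum'`, and
`δ ≤ deg` of every datum) and `deg D' = [Λ_{E'} : c' Λ_f] · δ` (degree formula). So the crux is
EQUIVALENT to: the cofactor `[Λ_{E'} : c' Λ_f]` of a minimal datum of a globally minimal `W'` is
`≤ 163` — the tree's `PastenShimura2024_minimalDegree_le_163_mul_iff` (hMK) — and in print that
cofactor is the degree of the minimal (cyclic) `ℚ`-isogeny `E_f → E'`, an element of Kenku's list
`{1,…,19,21,25,27,37,43,67,163}`; natural strengthening for provers: `deg D' / deg D ∈ kenkuDegrees`.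
[cite: Kenku1982] -/
theorem modularDegree_dvd_of_classMinimal {N : ℕ} [NeZero N] {W W' : WeierstrassCurve ℚ}
    [W.IsElliptic] (D : ModularParametrizationData W N) (D' : ModularParametrizationData W' N)
    (hf : D'.f = D.f)
    (hmin : ∀ (W'' : WeierstrassCurve ℚ) [W''.IsElliptic] (D'' : ModularParametrizationData W'' N),
      D''.f = D.f → D.modularDegree ≤ D''.modularDegree) :
    D.modularDegree ∣ D'.modularDegree := by
  have hf0 : D.f ≠ 0 := D.isNewformOf.1.ne_zero
  haveI := discreteTopology_periodLattice_of_mul_mem D.f D.cast_c_ne_zero D.smul_periodLattice_le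
  obtain ⟨δ, hδ, hfinδ⟩ := exists_degree_eichlerShimuraMap' (N := N) hf0
  obtain ⟨W₀, hW₀, D₀, hf₀, h₀⟩ := D.exists_optimalDatum'
  haveI := hW₀
  have hker₀ : D₀.isogenyMap.ker = ⊥ := D₀.isogenyMap_ker_eq_bot_iff.mpr h₀
  have hdeg₀ : D₀.modularDegree = δ := by
    obtain ⟨-, h⟩ := D₀.modularDegree_eq_card_ker_mul_of_eichlerShimuraMap hf₀ hδ hfinδ
    rw [h, hker₀, AddSubgroup.card_bot, one_mul]
  have hD : D.modularDegree = δ :=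
    le_antisymm (hdeg₀ ▸ hmin W₀ D₀ hf₀) (D.degree_eichlerShimuraMap_le_modularDegree rfl hδ hfinδ)
  obtain ⟨-, hdeg'⟩ := D'.modularDegree_eq_card_ker_mul_of_eichlerShimuraMap hf hδ hfinδ
  rw [hD, hdeg']
  exact Dvd.intro_left _ rfl

/-- **What is open, exactly (pointer, proved in the tree).** The crux is definitionally the vendored
fact and that fact is equivalent to the Néron-lattice form `hMK` of Mazur–Kenku
(`PastenShimura2024_minimalDegree_le_163_mul_iff`); its two printed inputs are the named fact
`mazurKenku_exists_cyclic_isogeny` (Mazur 1978 Thm 1 + Kenku 1982) and the integrality `hInt` of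
rational multipliers into the Néron lattice of a globally minimal parametrised curve
(`PastenShimura2024_minimalDegree_le_163_mul_of_mazurKenku`). The two `_false_without_` theorems
above say that BOTH inputs are used essentially: dropping `IsGloballyMinimal` kills `hInt`
(multiplier `1/13`), dropping `hmin'` kills the passage to a MINIMAL isogeny. [folklore] -/
theorem mazurKenkuBound_iff_hMK :
    MazurKenkuBound ↔
      ∀ {N : ℕ} [NeZero N] {W' : WeierstrassCurve ℚ} [W'.IsElliptic] [W'.IsGloballyMinimal]
        (D' : ModularParametrizationData W' N),
        ∃ (k : ℤ) (hk : ∀ z ∈ periodLattice D'.f, (k : ℂ) * z ∈ D'.L.lattice), k ≠ 0 ∧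
          Nat.card (mulQuotientMap (periodLattice D'.f) D'.L.lattice.toAddSubgroup (k : ℂ) hk).ker
            ≤ 163 :=
  PastenShimura2024_minimalDegree_le_163_mul_iff

/-! ## (d) Targets — line `Sketch` (lead prover-line-stmt-ABC-15125-0; PICKED 2026-08-16T10:31Z;
skeleton `Lines/Sketch.lean` @ 11:59Z, 7 stubs, 2 landed)

No stuck stubs handed over yet (`payload.stuck_stubs = []`). Cheap-falsity pass over the five open
stubs AS TYPED (all survive; none is refutable in the tree, each is a theorem in print):

* `stub_barrierExcluded` (73 degrees `B`, cyclic `ℚ`-isogenies avoid `B`): `B ∩ kenkuDegrees = ∅`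
  (checked: every `b ∈ B` is `≥ 20` and `∉ {21,25,27,37,43,67,163}`), so TRUE by Kenku 1982 (the
  cyclic degrees over `ℚ` are exactly Kenku's list). Degenerate instances: degree `0`/`1` are not in
  `B`; non-isogenous pairs have no isogeny. XL but sound.
* `stub_neronScaling` (I-ell): TRUE (Néron mapping property; `q = 0` allowed and integral;
  non-isogenous pairs admit only `q = 0` by `isIsogenous_iff_exists_int_mul_mem_lattice`).
  LOAD-BEARING in the strong sense: `mazurKenkuBound_false_without_minimalModel_of` is exactly its
  failure for a non-minimal target (`13⁻¹ • E_f`, scaling `1/13`): any restatement must keep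
  `IsGloballyMinimal` (or an explicit Néron-lattice hypothesis) on the TARGET `W'`; on `W₀` it is
  needed too (scaling `13` the other way round is harmless, but `W₀ := 13 • E_min` would give
  `q = 1/13` for the identity isogeny).
* `stub_optimalManinIntegral` (I-opt, Edixhoven Prop. 2 in lattice form `Λ' = qΛ_f ⇒ q ∈ ℤ`): TRUE
  (`z ↦ qz` is a `ℚ`-isomorphism `E_f → W'`, so `W'` is a minimal model of the strong Weil curve and
  `|q|` its Manin constant). Not weakened by the redundancy of (ii): (ii) concerns `D`, this
  concerns the optimal pivot.
* `stub_cor44` (Mazur Cor. 4.4 as `Mazur1978.cor44_valuation_j_le_one`): as typed it asserts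
  `j`-integrality at EVERY odd place INCLUDING `v = (N)`; Mazur's specialisation + formal-immersion
  argument covers all `p ≠ 2` (the section `∞` is smooth in every characteristic and torsion of
  `J̃(ℚ)` injects mod `p > 2`), and a posteriori (`N ∈ {11,17,19,37,43,67,163}`, the known `j`'s
  `−2¹⁵, −11², −11·131³, −17·373³/2¹⁷, −17²·101³/2, −7·11³, −7·137³·2083³`, CM values) every case is
  integral away from `2` — TRUE.
* `stub_prop51` (classes of `k`): the conclusion offers FIVE classes and lets `α'` absorb `μ₁₂`;
  Raynaud (`e ≤ 6 < N − 1`) forces the inertia character of the stable line to be `θ_K^j`,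
  `j ∈ {0, e}` (potentially ordinary) or `j = e/2` (potentially supersingular, `e` even), i.e.
  `k₀ ∈ {0, 1, 1/2}` up to the absorbed ambiguity — inside the five classes. TRUE (weaker than print).

Joint sufficiency is kernel-checked (`MazurKenkuBound_of` composes the seven stubs BY NAME).
-/

/-! ## (e) Near-misses / not formalisable today (prose record; no `sorry` kept)

* Hypothesis (i) `D'.f = D.f` is load-bearing on paper (two isogeny classes of one conductor with
  `m_{E'} > 163 · m_E`, e.g. Cremona/Watkins tables at `N ≤ 10⁵` contain degree ratios `> 10³`), but a
  witness needs data on two specific curves — modularity of named curves is not in the tree.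
* Tightness of `163`: `N = 26569 = 163²`, the CM class `{E, E'}` of discriminant `−163` is joined only
  by a cyclic `163`-isogeny (Kenku), so the minimal datum of the non-optimal minimal model has degree
  exactly `163 · δ`; `162` would be false. Needs data on those two curves: same obstruction.
* An UNCONDITIONAL `¬ MazurKenkuBound` is not expected: the statement is a theorem in print and the
  structure `ModularParametrizationData` has no exotic inhabitants (every field is pinned: `f` by
  `aₙ(f) = aₙ(W)`, `Λ_E` by `g₂, g₃`, `uniformize` by kernel + `℘`-formula, `deg` by `deg_spec`; the
  only freedom is the admissible integer `c`, and degrees are `[Λ_E : cΛ_f] · δ`).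
-/

end Summit.ABC.ABC.Cruxes.MazurKenkuBound.Disproof

end
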